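import Literature.MathematicalPhysics.QuantumFieldTheory.Balaban1983to89.Node00.Record13SepCoPInhabitedOfThm1CCMWGaugeRSignFree
import Summits.QuantumFields.YangMills.Theorems.BalabanUVNodesK0ROfStepTokensRCube
import Summits.QuantumFields.YangMills.Theorems.BalabanUVNodesN26AtRecord13BetaBoxOfDriftAtSlope

/-!
# BalabanUVNodes ∕ K0 ROAD — THE SIGN-FREE STUB 3ᴬ: K0⁷'s body from [15] Proposition 8's top step, [6] Proposition 6 at NODE 00's member, the rider `F.m ≤ 3`, and «the β-functions of
# record of A1's witness `θ₁₅ᶜᶜᴹ(3)` are UNIFORMLY BOUNDED (two-sided, `|β| ≤ β′`) on SOME window `]0, γ₀]`» — NO SIGN OF β; and its SUPPLIER JUNCTION: NODE O's jets-free pair at the witness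
# gives 3ᴬ through N26's `exists_betaBox_betaOfRecord₁₃_of_jetsFreePair` BY NAME

CREDIT.  The finding «THE SIGN OF β IS NOT READ BY THE K0 NODE» and this chain are node O's: ideation seat `ym-nodeO-ideate` P3 g48, memo companion
`run/shared/lean/pub/ym-nodeO-ideate/memos/lines/BetaBoxSignFree-P3g48.lean` (sha256 272e4beb1cdd2f4f…, §4b ∕ §5), EVIDENCE-N78 on the `pub-ymgap` bus 2026-08-27T19:24:46Z; plan g77
SIGNFREE-WORD 19:25Z (V17 = stub 3 ↦ 3ᴬ on this file, LANDED + BUILT).  Re-homed in the tree, `def`-free (3ᴬ and the jets-free pair are DISPLAYED hypotheses, texts verbatim), by seat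
`pub-ymgap-dag-n21-c` (g12) = FILE Cʷ′.  Consumed BY NAME: Eʷ `Node00.Record13SepCoPInhabitedOfThm1CCMWGaugeRSignFree` (`…_of_hcomp_cube`), Dʷ `Node00.Record13SignFreeComparabilityOfBetaBox`
(`exists_window_letters_signFree`, `hcompBoth_theta13OfThm1CCMW_of_betaBoxSignFree_half`), FILE C (`shrunkCeiling_pos`, `gauge9R_cube_of_prop8TopStep_of_prop6Member`), N07's bridge,
dag-n07-e's FILE 29 (`b9Of`, `a0Of`), N26 (`exists_betaBox_betaOfRecord₁₃_of_jetsFreePair`), `FlowStep.box_mono`.  `--kind proof --supports stmt-QuantumFields-20541 --as helper`.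
[15] = [Balaban1985Variational]; [6] = [Balaban1985RegularSpaces]; [III] = [Balaban1988Convergent]; [I] = [Balaban1987RG1]; [II] = [Balaban1989LargeFieldII]; [IIc] = [Balaban1988RG2Cluster]; [IV] = [Balaban1989LargeFieldI].

WHY.  V15's 3′, and Cʷ's 3ʷ ⇔ 3ˢ ⇐ 3ᵀ, all carry the SIGN `0 ≤ β` (T09.F, [II] p.355 ∕ (1.4) — UNPRINTED, idea-bound), because 13e∕A2 derived (hcomp) from monotone histories.  B′ §5's socket
reads (hcomp) ∧ (hcompRev) only, and Dʷ gets BOTH from a two-sided bound of either sign on a window small against the bound.  So stub 3 need only say «`|β₁₃(θ₁₅ᶜᶜᴹ(3))| ≤ β′` on SOME `]0, γ₀]`»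
= [I] Thm 1 p.259 ∕ §1 p.264 «uniformly bounded» (STATED in print; the content of [I] Thm 2 p.259, proof unpublished — the B12-THM2 ∕ node O (D1)+(D4) lane), and THAT text has a typed
SUPPLIER in the tree: N26's jets-free-pair lemma (K2⁗'s two stub bodies read at the record).

WHAT THIS FILE PROVES (theorems only; 0 `def`).
§1 ★★★ʷ± `exists_k0H_of_prop8TopStep_of_prop6Member_of_clausesH (hm : 4 ≤ F.m) … (hγ0) (hγ) (hε) (hε') (hcomp) (hcompRev)` — Cʷ's `_of_clausesW` with (hcomp) for (hmono).
§2 3ᴬ AND ITS ROAD (texts spelled out, no `def`): `absBetaBox_of_signBetaBox` (Cʷ's 3ˢ ⇒ 3ᴬ — so V16's stub by name stays un-refuted), `windowLettersBox_of_absBetaBox` (3ᴬ ⇒ the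
   windowed two-sided box with letters on a shrunk `γ ≤ ½`, Dʷ §0), ★★ `clausesH_of_absBetaBox` (3ᴬ ⇒ the sign-free clause form at `θ₁₅ᶜᶜᴹ(3; γ)`), ★★★ `record13SepCoPHBody_of_stubsA
   (h1 : stub 1) (h2 : stub 2) (h3A : 3ᴬ) (h4 : stub 4) : ∀ F, ⁷-body F` — THE V17 COMPOSITION (h1∕h2∕h4 = V15∕V16 texts verbatim).
§3 THE SUPPLIER SIDE: `exists_windowLettersBox_of_absBox (θ)` (N26's output shape at any θ ⟹ letters box on `γ ≤ min(θ.γ, ½)`), ★★ `absBetaBox_of_jetsFreePair` (NODE O's jets-free pair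
   at `θ₁₅ᶜᶜᴹ(3)` for every guarded tuple ⟹ 3ᴬ; N26 BY NAME), ★★★★ `record13SepCoPHBody_of_stubs12_jetsFreePair_rider` (end to end, sign-free).
CHAIN: 3′ ⇒ 3ʷ ⇔ 3ˢ ⇒ 3ᴬ ⇐ jets-free pair; every step a weakening; nothing refuted.

HONEST FRAMING.  Compositions of tree theorems + Dʷ's window arithmetic; CONDITIONAL on [15] Prop. 8's top step (N07), [6] Prop. 6 at the member (N05), 3ᴬ resp. the jets-free pair (NODE O ∕
K2⁗'s (D1)+(D4) at one record — NOT proved), the rider and the signs — all DISPLAYED hypotheses, never asserted; NO sign of β derived or assumed anywhere (T09.F stands, for the flow ∕ K2 side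
where it is read); nothing of Bałaban asserted or discharged; K0⁷ ∕ K2⁷ OPEN; V16 is the skeleton OF RECORD — 3ᴬ is the plan's announced V17 re-cut, not a re-registration by this seat;
counts unmoved (typed 28∕28 · discharged 5∕27); one finite 𝕋⁴ programme at fixed ε — NOT continuum ∕ OS ∕ mass gap ∕ Clay.  No `sorry`, `def`, `instance`, `notation`.
-/

noncomputable section

open scoped Matrix.Norms.L2Operator

namespace Summit.QuantumFields.YangMills.Theorems.K0SignFreeOfStepTokensRCube

open Literature.MathematicalPhysics.QuantumFieldTheory.Balaban1983to89
open Literature.MathematicalPhysics.QuantumFieldTheory.Balaban1983to89.Node00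
open Literature.MathematicalPhysics.QuantumFieldTheory.Balaban1983to89.T4Continuum
open Literature.MathematicalPhysics.QuantumFieldTheory.Balaban1983to89.FlowStep
open Literature.MathematicalPhysics.QuantumFieldTheory.Balaban1983to89.Beta.Drift (OneLoopDrift)
open Summit.QuantumFields.BalabanUV.Gaps.BetaContFromD4Chain (AtSlopeCont)
open Summit.QuantumFields.YangMills.BalabanUVNodes.N07Thm1Top7FromProp8 (variationalThm1RegSepCoP7M_of_prop8TopStep)
open Summit.QuantumFields.YangMills.Theorems.K0ROfStepTokensRCube (shrunkCeiling_pos gauge9R_cube_of_prop8TopStep_of_prop6Member)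
open Summit.QuantumFields.YangMills.Theorems.BalabanUVNodesN26AtRecord13BetaBoxOfDriftAtSlope (exists_betaBox_betaOfRecord₁₃_of_jetsFreePair)

/-! ## §1. The ⁷ K0 body for `F` (`4 ≤ F.m`) from the two printed inputs, the signs, and the SIGN-FREE clauses (hcomp) ∧ (hcompRev) at `θ₁₅ᶜᶜᴹ(3; γ)` -/

section Cube

variable (F : T4Family)

/-- **★★★ʷ± THE ⁷ K0 BODY FOR `F` (`4 ≤ F.m`) AT `N = 2` FROM [15] PROP. 8's TOP STEP, [6] PROP. 6 AT NODE 00's MEMBER AND THE SIGN-FREE CLAUSES (hcomp) ∧ (hcompRev) AT `θ₁₅ᶜᶜᴹ(3; γ)`** —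
Cʷ's `exists_k0H_of_prop8TopStep_of_prop6Member_of_clausesW` with (hcomp) for (hmono); same proof shape over Eʷ's `_of_hcomp_cube`.  CONDITIONAL on every displayed hypothesis; K0⁷ NOT closed here.
(node O P3 g48 §4b.) [cite: Balaban1985Variational, Thm 1 (8)–(9) p.279, (144)–(152) pp.300–301, Prop. 8 p.304; Balaban1985RegularSpaces, Prop. 6 p.99; Balaban1988Convergent, Thm 1 p.262, (2.6)–(2.8) pp.255–256, (2.21) p.258; Balaban1987RG1, Thm 1 p.259] -/
theorem exists_k0H_of_prop8TopStep_of_prop6Member_of_clausesH (hm : 4 ≤ F.m) {B₃ a₀ a₁ B₁ c₁ : ℝ} (hB₃ : 2 * (F.L : ℝ) ^ 2 ≤ B₃) (ha₀ : 0 < a₀) (ha₁ : 0 < a₁)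
    (h8 : Prop8RegSepTopStep F 2 (fun ν K Ω => suppDomOfRecord F ν K Ω) B₃ a₀ a₁) (hB₁ : 0 ≤ B₁) (hc₁ : 0 < c₁)
    (hP6 : letI : CStarAlgebra (MatA 2) := {}; B8.Prop6Printed 4 (F.L : ℝ) B₁ c₁ (fun i : B8LeafModelZd.ZdIdx 4 F.L => zdCub (MatA 2) F.L i))
    {γ ε₀ ε₂₉ : ℝ} (hγ0 : 0 < γ) (hγ : γ ≤ 1 / 2) (hε : 0 < ε₀) (hε' : 0 < ε₂₉)
    (hcomp : ∀ (p : B12.RunParams) (n : ℕ), n ≤ p.K →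
      Step.InInterval (theta13OfThm1CCMW F 2 3 γ ε₀ ε₂₉ B₃ (b9Of F (F.L ^ 3) B₁ * B₃) a₀ (min a₁ (a0Of F 2 (F.L ^ 3) B₁ c₁ / B₃))).γ n
        (gOfRecord₁₃ F 2 (theta13OfThm1CCMW F 2 3 γ ε₀ ε₂₉ B₃ (b9Of F (F.L ^ 3) B₁ * B₃) a₀ (min a₁ (a0Of F 2 (F.L ^ 3) B₁ c₁ / B₃))) p) → ∀ m, m < n →
      (theta13OfThm1CCMW F 2 3 γ ε₀ ε₂₉ B₃ (b9Of F (F.L ^ 3) B₁ * B₃) a₀ (min a₁ (a0Of F 2 (F.L ^ 3) B₁ c₁ / B₃))).s2.cR *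
          epsOfRecord (theta13OfThm1CCMW F 2 3 γ ε₀ ε₂₉ B₃ (b9Of F (F.L ^ 3) B₁ * B₃) a₀ (min a₁ (a0Of F 2 (F.L ^ 3) B₁ c₁ / B₃))).ν
            (gOfRecord₁₃ F 2 (theta13OfThm1CCMW F 2 3 γ ε₀ ε₂₉ B₃ (b9Of F (F.L ^ 3) B₁ * B₃) a₀ (min a₁ (a0Of F 2 (F.L ^ 3) B₁ c₁ / B₃))) p) m ≤
        2 * ((theta13OfThm1CCMW F 2 3 γ ε₀ ε₂₉ B₃ (b9Of F (F.L ^ 3) B₁ * B₃) a₀ (min a₁ (a0Of F 2 (F.L ^ 3) B₁ c₁ / B₃))).s2.cR *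
          epsOfRecord (theta13OfThm1CCMW F 2 3 γ ε₀ ε₂₉ B₃ (b9Of F (F.L ^ 3) B₁ * B₃) a₀ (min a₁ (a0Of F 2 (F.L ^ 3) B₁ c₁ / B₃))).ν
            (gOfRecord₁₃ F 2 (theta13OfThm1CCMW F 2 3 γ ε₀ ε₂₉ B₃ (b9Of F (F.L ^ 3) B₁ * B₃) a₀ (min a₁ (a0Of F 2 (F.L ^ 3) B₁ c₁ / B₃))) p) (m + 1)))
    (hcompRev : ∀ (p : B12.RunParams) (n : ℕ), n ≤ p.K →
      Step.InInterval (theta13OfThm1CCMW F 2 3 γ ε₀ ε₂₉ B₃ (b9Of F (F.L ^ 3) B₁ * B₃) a₀ (min a₁ (a0Of F 2 (F.L ^ 3) B₁ c₁ / B₃))).γ n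
        (gOfRecord₁₃ F 2 (theta13OfThm1CCMW F 2 3 γ ε₀ ε₂₉ B₃ (b9Of F (F.L ^ 3) B₁ * B₃) a₀ (min a₁ (a0Of F 2 (F.L ^ 3) B₁ c₁ / B₃))) p) → ∀ m, m < n →
      (theta13OfThm1CCMW F 2 3 γ ε₀ ε₂₉ B₃ (b9Of F (F.L ^ 3) B₁ * B₃) a₀ (min a₁ (a0Of F 2 (F.L ^ 3) B₁ c₁ / B₃))).s2.cR *
          epsOfRecord (theta13OfThm1CCMW F 2 3 γ ε₀ ε₂₉ B₃ (b9Of F (F.L ^ 3) B₁ * B₃) a₀ (min a₁ (a0Of F 2 (F.L ^ 3) B₁ c₁ / B₃))).ν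
            (gOfRecord₁₃ F 2 (theta13OfThm1CCMW F 2 3 γ ε₀ ε₂₉ B₃ (b9Of F (F.L ^ 3) B₁ * B₃) a₀ (min a₁ (a0Of F 2 (F.L ^ 3) B₁ c₁ / B₃))) p) (m + 1) ≤
        2 * ((theta13OfThm1CCMW F 2 3 γ ε₀ ε₂₉ B₃ (b9Of F (F.L ^ 3) B₁ * B₃) a₀ (min a₁ (a0Of F 2 (F.L ^ 3) B₁ c₁ / B₃))).s2.cR *
          epsOfRecord (theta13OfThm1CCMW F 2 3 γ ε₀ ε₂₉ B₃ (b9Of F (F.L ^ 3) B₁ * B₃) a₀ (min a₁ (a0Of F 2 (F.L ^ 3) B₁ c₁ / B₃))).ν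
            (gOfRecord₁₃ F 2 (theta13OfThm1CCMW F 2 3 γ ε₀ ε₂₉ B₃ (b9Of F (F.L ^ 3) B₁ * B₃) a₀ (min a₁ (a0Of F 2 (F.L ^ 3) B₁ c₁ / B₃))) p) m)) :
    ∃ θ : Stage13HParams F 2, θ.Provisos₁₃SepCoPH F 2 ∧ (θ.ZhUnity F 2 ∧ θ.SlotsNondegenerate₁₃ F 2) ∧ θ.Admissible F 2 := by
  have hL : (0 : ℝ) < (F.L : ℝ) := by exact_mod_cast lt_trans Nat.zero_lt_one F.hL.2
  have hBpos : (0 : ℝ) < B₃ := lt_of_lt_of_le (mul_pos two_pos (pow_pos hL 2)) hB₃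
  have hB9 : 0 ≤ b9Of F (F.L ^ 3) B₁ * B₃ := mul_nonneg (b9Of_pos (F := F) (F.L ^ 3) hB₁).le hBpos.le
  exact exists_k0SepCoPH_thm1CCMW_of_gauge9TopStepR_of_hcomp_cube F hm hγ0 hγ hε hε' hBpos.le hB9 ha₀ (shrunkCeiling_pos F (F.L ^ 3) hBpos hB₁ hc₁ ha₁)
    (variationalThm1RegSepCoP7M_of_prop8TopStep hBpos (h8.of_le le_rfl (min_le_left _ _))) (gauge9R_cube_of_prop8TopStep_of_prop6Member F hBpos h8 hB₁ hc₁ hP6)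
    hcomp hcompRev

end Cube

/-! ## §2. 3ᴬ — «`|β₁₃(θ₁₅ᶜᶜᴹ(3))| ≤ β′` on SOME window» — and its road to K0⁷'s body (texts spelled out; no `def`) -/

section SignFree

/-- **3ˢ ⟹ 3ᴬ AT `F`** (Cʷ's sign-stub text, displayed verbatim as the hypothesis, implies the sign-free text: `β″ := max β′ 0`) — so 3ᴬ is WEAKER than each of 3′ ⇒ 3ʷ ⇔ 3ˢ ⇐ 3ᵀ and V16's
registered stub implies V17's by name.  (node O P3 g48 §4b.) [cite: Balaban1987RG1, §1 p.264 (bookkeeping)] -/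
theorem absBetaBox_of_signBetaBox (F : T4Family)
    (h3S : ∀ B₃ B₃' a₀ a₁ : ℝ, 2 * (F.L : ℝ) ^ 2 ≤ B₃ → 0 < B₃' → 0 < a₀ → 0 < a₁ →
      VariationalThm1RegSepCoP7M F 2 B₃ a₀ a₁ →
      Gauge9RegSepTopStepR F 2 (fun ν K Ω => suppDomOfRecord F ν K Ω) (F.L ^ 3) ((11 * 4 + 3 * F.L) * F.L) B₃ B₃' a₀ a₁ →
      ∃ γ₀ ε₀ ε₂₉ β' : ℝ, 0 < γ₀ ∧ 0 < ε₀ ∧ 0 < ε₂₉ ∧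
        BetaLowerH 0 γ₀ (betaOfRecord₁₃ F 2 (theta13OfThm1CCM F 2 3 ε₀ ε₂₉ B₃ B₃' a₀ a₁)) ∧
        BetaUpperH β' γ₀ (betaOfRecord₁₃ F 2 (theta13OfThm1CCM F 2 3 ε₀ ε₂₉ B₃ B₃' a₀ a₁))) :
    ∀ B₃ B₃' a₀ a₁ : ℝ, 2 * (F.L : ℝ) ^ 2 ≤ B₃ → 0 < B₃' → 0 < a₀ → 0 < a₁ →
      VariationalThm1RegSepCoP7M F 2 B₃ a₀ a₁ →
      Gauge9RegSepTopStepR F 2 (fun ν K Ω => suppDomOfRecord F ν K Ω) (F.L ^ 3) ((11 * 4 + 3 * F.L) * F.L) B₃ B₃' a₀ a₁ →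
      ∃ γ₀ ε₀ ε₂₉ β' : ℝ, 0 < γ₀ ∧ 0 < ε₀ ∧ 0 < ε₂₉ ∧
        BetaLowerH (-β') γ₀ (betaOfRecord₁₃ F 2 (theta13OfThm1CCM F 2 3 ε₀ ε₂₉ B₃ B₃' a₀ a₁)) ∧
        BetaUpperH β' γ₀ (betaOfRecord₁₃ F 2 (theta13OfThm1CCM F 2 3 ε₀ ε₂₉ B₃ B₃' a₀ a₁)) := by
  intro B₃ B₃' a₀ a₁ hB₃ hB₃' ha₀ ha₁ h15 h9
  obtain ⟨γ₀, ε₀, ε₂₉, β', hγ0, hε, hε', hlow, hup⟩ := h3S B₃ B₃' a₀ a₁ hB₃ hB₃' ha₀ ha₁ h15 h9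
  refine ⟨γ₀, ε₀, ε₂₉, max β' 0, hγ0, hε, hε', fun k v hv => ?_, fun k v hv => (hup k v hv).trans (le_max_left _ _)⟩
  have h0 : -(max β' 0) ≤ 0 := neg_nonpos.mpr (le_max_right _ _)
  exact h0.trans (hlow k v hv)

/-- **3ᴬ ⟹ THE WINDOWED TWO-SIDED BOX WITH LETTERS AT `F`**: the abs box on some window gives, on a shrunk window `γ ≤ ½` (Dʷ §0), the two-sided box of A1's witness with `−bₗ·γ² ≤ 3`,
`β′·γ² ≤ ¾` (`bₗ := −β′`; `0 ≤ β′` is read off the non-empty box `]0, γ₀]^1`) — Eʷ's `_betaBoxSignFree_half_cube` hypotheses.  (node O P3 g48 §4b.) [cite: Balaban1987RG1, §1 p.264 (bookkeeping)] -/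
theorem windowLettersBox_of_absBetaBox (F : T4Family)
    (h3A : ∀ B₃ B₃' a₀ a₁ : ℝ, 2 * (F.L : ℝ) ^ 2 ≤ B₃ → 0 < B₃' → 0 < a₀ → 0 < a₁ →
      VariationalThm1RegSepCoP7M F 2 B₃ a₀ a₁ →
      Gauge9RegSepTopStepR F 2 (fun ν K Ω => suppDomOfRecord F ν K Ω) (F.L ^ 3) ((11 * 4 + 3 * F.L) * F.L) B₃ B₃' a₀ a₁ →
      ∃ γ₀ ε₀ ε₂₉ β' : ℝ, 0 < γ₀ ∧ 0 < ε₀ ∧ 0 < ε₂₉ ∧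
        BetaLowerH (-β') γ₀ (betaOfRecord₁₃ F 2 (theta13OfThm1CCM F 2 3 ε₀ ε₂₉ B₃ B₃' a₀ a₁)) ∧
        BetaUpperH β' γ₀ (betaOfRecord₁₃ F 2 (theta13OfThm1CCM F 2 3 ε₀ ε₂₉ B₃ B₃' a₀ a₁))) :
    ∀ B₃ B₃' a₀ a₁ : ℝ, 2 * (F.L : ℝ) ^ 2 ≤ B₃ → 0 < B₃' → 0 < a₀ → 0 < a₁ →
      VariationalThm1RegSepCoP7M F 2 B₃ a₀ a₁ →
      Gauge9RegSepTopStepR F 2 (fun ν K Ω => suppDomOfRecord F ν K Ω) (F.L ^ 3) ((11 * 4 + 3 * F.L) * F.L) B₃ B₃' a₀ a₁ →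
      ∃ γ ε₀ ε₂₉ bl β' : ℝ, 0 < γ ∧ γ ≤ 1 / 2 ∧ 0 < ε₀ ∧ 0 < ε₂₉ ∧ -bl * γ ^ 2 ≤ 3 ∧ β' * γ ^ 2 ≤ 3 / 4 ∧
        BetaLowerH bl γ (betaOfRecord₁₃ F 2 (theta13OfThm1CCM F 2 3 ε₀ ε₂₉ B₃ B₃' a₀ a₁)) ∧
        BetaUpperH β' γ (betaOfRecord₁₃ F 2 (theta13OfThm1CCM F 2 3 ε₀ ε₂₉ B₃ B₃' a₀ a₁)) := by
  intro B₃ B₃' a₀ a₁ hB₃ hB₃' ha₀ ha₁ h15 h9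
  obtain ⟨γ₀, ε₀, ε₂₉, β', hγ0, hε, hε', hlow, hup⟩ := h3A B₃ B₃' a₀ a₁ hB₃ hB₃' ha₀ ha₁ h15 h9
  have hv : (fun _ : Fin (0 + 1) => γ₀) ∈ Box γ₀ 0 := mem_box.mpr fun _ => ⟨hγ0, le_rfl⟩
  have hβ' : 0 ≤ β' := by
    have h1 := hlow 0 _ hv
    have h2 := hup 0 _ hv
    linarith
  obtain ⟨γ, hγpos, hγle, hγhalf, hl, hu⟩ := exists_window_letters_signFree hγ0 hβ'
  exact ⟨γ, ε₀, ε₂₉, -β', β', hγpos, hγhalf, hε, hε', hl, hu,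
    fun k v hv => hlow k v (box_mono hγle k hv), fun k v hv => hup k v (box_mono hγle k hv)⟩

/-- **★★ 3ᴬ ⟹ 3ᶜʰ, THE SIGN-FREE CLAUSE FORM AT THE WINDOW EDITION**: for every guarded constants tuple carrying (8) and the R step fact, SOME window `γ ∈ ]0, ½]` and thresholds `ε₀, ε₂₉ > 0` with
(hcomp) ∧ (hcompRev) along every `γ`-windowed run of `θ₁₅ᶜᶜᴹ(3; γ)` (Dʷ ★★ʷ ∘ `windowLettersBox_of_absBetaBox`).  CONDITIONAL on 3ᴬ.  (node O P3 g48 §4b.)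
[cite: Balaban1987RG1, Thm 1 p.259, (0.20) p.256, (1.20)–(1.22) p.264, §1 p.264; Balaban1988Convergent, (2.4)–(2.8) pp.255–256] -/
theorem clausesH_of_absBetaBox (F : T4Family)
    (h3A : ∀ B₃ B₃' a₀ a₁ : ℝ, 2 * (F.L : ℝ) ^ 2 ≤ B₃ → 0 < B₃' → 0 < a₀ → 0 < a₁ →
      VariationalThm1RegSepCoP7M F 2 B₃ a₀ a₁ →
      Gauge9RegSepTopStepR F 2 (fun ν K Ω => suppDomOfRecord F ν K Ω) (F.L ^ 3) ((11 * 4 + 3 * F.L) * F.L) B₃ B₃' a₀ a₁ →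
      ∃ γ₀ ε₀ ε₂₉ β' : ℝ, 0 < γ₀ ∧ 0 < ε₀ ∧ 0 < ε₂₉ ∧
        BetaLowerH (-β') γ₀ (betaOfRecord₁₃ F 2 (theta13OfThm1CCM F 2 3 ε₀ ε₂₉ B₃ B₃' a₀ a₁)) ∧
        BetaUpperH β' γ₀ (betaOfRecord₁₃ F 2 (theta13OfThm1CCM F 2 3 ε₀ ε₂₉ B₃ B₃' a₀ a₁))) :
    ∀ B₃ B₃' a₀ a₁ : ℝ, 2 * (F.L : ℝ) ^ 2 ≤ B₃ → 0 < B₃' → 0 < a₀ → 0 < a₁ →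
      VariationalThm1RegSepCoP7M F 2 B₃ a₀ a₁ →
      Gauge9RegSepTopStepR F 2 (fun ν K Ω => suppDomOfRecord F ν K Ω) (F.L ^ 3) ((11 * 4 + 3 * F.L) * F.L) B₃ B₃' a₀ a₁ →
      ∃ γ ε₀ ε₂₉ : ℝ, 0 < γ ∧ γ ≤ 1 / 2 ∧ 0 < ε₀ ∧ 0 < ε₂₉ ∧
        (∀ (p : B12.RunParams) (n : ℕ), n ≤ p.K → Step.InInterval (theta13OfThm1CCMW F 2 3 γ ε₀ ε₂₉ B₃ B₃' a₀ a₁).γ n (gOfRecord₁₃ F 2 (theta13OfThm1CCMW F 2 3 γ ε₀ ε₂₉ B₃ B₃' a₀ a₁) p) → ∀ m, m < n →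
          (theta13OfThm1CCMW F 2 3 γ ε₀ ε₂₉ B₃ B₃' a₀ a₁).s2.cR * epsOfRecord (theta13OfThm1CCMW F 2 3 γ ε₀ ε₂₉ B₃ B₃' a₀ a₁).ν (gOfRecord₁₃ F 2 (theta13OfThm1CCMW F 2 3 γ ε₀ ε₂₉ B₃ B₃' a₀ a₁) p) m ≤
            2 * ((theta13OfThm1CCMW F 2 3 γ ε₀ ε₂₉ B₃ B₃' a₀ a₁).s2.cR * epsOfRecord (theta13OfThm1CCMW F 2 3 γ ε₀ ε₂₉ B₃ B₃' a₀ a₁).ν (gOfRecord₁₃ F 2 (theta13OfThm1CCMW F 2 3 γ ε₀ ε₂₉ B₃ B₃' a₀ a₁) p) (m + 1))) ∧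
        (∀ (p : B12.RunParams) (n : ℕ), n ≤ p.K → Step.InInterval (theta13OfThm1CCMW F 2 3 γ ε₀ ε₂₉ B₃ B₃' a₀ a₁).γ n (gOfRecord₁₃ F 2 (theta13OfThm1CCMW F 2 3 γ ε₀ ε₂₉ B₃ B₃' a₀ a₁) p) → ∀ m, m < n →
          (theta13OfThm1CCMW F 2 3 γ ε₀ ε₂₉ B₃ B₃' a₀ a₁).s2.cR * epsOfRecord (theta13OfThm1CCMW F 2 3 γ ε₀ ε₂₉ B₃ B₃' a₀ a₁).ν (gOfRecord₁₃ F 2 (theta13OfThm1CCMW F 2 3 γ ε₀ ε₂₉ B₃ B₃' a₀ a₁) p) (m + 1) ≤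
            2 * ((theta13OfThm1CCMW F 2 3 γ ε₀ ε₂₉ B₃ B₃' a₀ a₁).s2.cR * epsOfRecord (theta13OfThm1CCMW F 2 3 γ ε₀ ε₂₉ B₃ B₃' a₀ a₁).ν (gOfRecord₁₃ F 2 (theta13OfThm1CCMW F 2 3 γ ε₀ ε₂₉ B₃ B₃' a₀ a₁) p) m)) := by
  intro B₃ B₃' a₀ a₁ hB₃ hB₃' ha₀ ha₁ h15 h9
  obtain ⟨γ, ε₀, ε₂₉, bl, β', hγ0, hγ, hε, hε', hl, hu, hlow, hup⟩ := windowLettersBox_of_absBetaBox F h3A B₃ B₃' a₀ a₁ hB₃ hB₃' ha₀ ha₁ h15 h9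
  have hL : (0 : ℝ) < (F.L : ℝ) := by exact_mod_cast lt_trans Nat.zero_lt_one F.hL.2
  have hB : (0 : ℝ) ≤ B₃ := (mul_pos two_pos (pow_pos hL 2)).le.trans hB₃
  exact ⟨γ, ε₀, ε₂₉, hγ0, hγ, hε, hε', hcompBoth_theta13OfThm1CCMW_of_betaBoxSignFree_half hγ hB hB₃'.le ha₀.le ha₁.le hlow hup hl hu⟩

/-- **★★★ THE V17 COMPOSITION, SIGN-FREE — K0⁷'s BODY AT EVERY FAMILY from stub 1 ([15] Prop. 8's top step for SOME guarded `(B₃, a₀, a₁)`), stub 2 ([6] Prop. 6 at NODE 00's member), THE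
ABS STUB 3ᴬ («for every guarded constants tuple carrying (8) and the R step fact, SOME window `γ₀ > 0`, thresholds `ε₀, ε₂₉ > 0` and a bound `β′` with `−β′ ≤ β₁₃(θ₁₅ᶜᶜᴹ(3)) ≤ β′` on every
`]0, γ₀]^{k+1}`») and stub 4 (the rider `F.m ≤ 3`)** — texts of 1, 2, 4 exactly V15∕V16's; 3ˢ replaced by the WEAKER 3ᴬ (no sign).  Proof: 3ᴬ ⟹ 3ᶜʰ ⟹ §1 on print's range, `h4` below it.
Hypothesis form, no `sorry`; CONDITIONAL; K0⁷ NOT closed; nothing of Bałaban asserted.  (node O P3 g48 §4b.) [cite: Balaban1985Variational, Thm 1 (8)–(9) p.279, (152) p.301, Prop. 8 p.304; Balaban1985RegularSpaces, Prop. 6 p.99; Balaban1988Convergent, Thm 1 p.262, (2.6)–(2.8) pp.255–256, (3.16)–(3.23) pp.268–270; Balaban1987RG1, Thm 1 p.259, §1 p.264; Balaban1989LargeFieldI, (0.2)–(0.4) p.176] -/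
theorem record13SepCoPHBody_of_stubsA
    (h1 : ∀ F : T4Family, ∃ B₃ a₀ a₁ : ℝ, 2 * (F.L : ℝ) ^ 2 ≤ B₃ ∧ 0 < a₀ ∧ 0 < a₁ ∧
      Prop8RegSepTopStep F 2 (fun ν K Ω => suppDomOfRecord F ν K Ω) B₃ a₀ a₁)
    (h2 : ∀ F : T4Family, ∃ B₁ c₁ : ℝ, 0 ≤ B₁ ∧ 0 < c₁ ∧
      (letI : CStarAlgebra (MatA 2) := {}; B8.Prop6Printed 4 (F.L : ℝ) B₁ c₁ (fun i : B8LeafModelZd.ZdIdx 4 F.L => zdCub (MatA 2) F.L i)))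
    (h3A : ∀ (F : T4Family) (B₃ B₃' a₀ a₁ : ℝ), 2 * (F.L : ℝ) ^ 2 ≤ B₃ → 0 < B₃' → 0 < a₀ → 0 < a₁ →
      VariationalThm1RegSepCoP7M F 2 B₃ a₀ a₁ →
      Gauge9RegSepTopStepR F 2 (fun ν K Ω => suppDomOfRecord F ν K Ω) (F.L ^ 3) ((11 * 4 + 3 * F.L) * F.L) B₃ B₃' a₀ a₁ →
      ∃ γ₀ ε₀ ε₂₉ β' : ℝ, 0 < γ₀ ∧ 0 < ε₀ ∧ 0 < ε₂₉ ∧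
        BetaLowerH (-β') γ₀ (betaOfRecord₁₃ F 2 (theta13OfThm1CCM F 2 3 ε₀ ε₂₉ B₃ B₃' a₀ a₁)) ∧
        BetaUpperH β' γ₀ (betaOfRecord₁₃ F 2 (theta13OfThm1CCM F 2 3 ε₀ ε₂₉ B₃ B₃' a₀ a₁)))
    (h4 : ∀ F : T4Family, F.m ≤ 3 → ∃ θ : Stage13HParams F 2, θ.Provisos₁₃SepCoPH F 2 ∧ (θ.ZhUnity F 2 ∧ θ.SlotsNondegenerate₁₃ F 2) ∧ θ.Admissible F 2) :
    ∀ F : T4Family, ∃ θ : Stage13HParams F 2, θ.Provisos₁₃SepCoPH F 2 ∧ (θ.ZhUnity F 2 ∧ θ.SlotsNondegenerate₁₃ F 2) ∧ θ.Admissible F 2 := by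
  intro F
  by_cases hm : 4 ≤ F.m
  · obtain ⟨B₃, a₀, a₁, hB₃, ha₀, ha₁, h8⟩ := h1 F
    have hL : (0 : ℝ) < (F.L : ℝ) := by exact_mod_cast lt_trans Nat.zero_lt_one F.hL.2
    have hBpos : (0 : ℝ) < B₃ := lt_of_lt_of_le (mul_pos two_pos (pow_pos hL 2)) hB₃
    obtain ⟨B₁, c₁, hB₁, hc₁, hP6⟩ := h2 F
    have ha₁' : 0 < min a₁ (a0Of F 2 (F.L ^ 3) B₁ c₁ / B₃) := shrunkCeiling_pos F (F.L ^ 3) hBpos hB₁ hc₁ ha₁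
    have hB₉ : 0 < b9Of F (F.L ^ 3) B₁ * B₃ := mul_pos (b9Of_pos (F := F) (F.L ^ 3) hB₁) hBpos
    obtain ⟨γ, ε₀, ε₂₉, hγ0, hγ, hε, hε', hcomp, hcompRev⟩ :=
      clausesH_of_absBetaBox F (h3A F) B₃ (b9Of F (F.L ^ 3) B₁ * B₃) a₀ (min a₁ (a0Of F 2 (F.L ^ 3) B₁ c₁ / B₃)) hB₃ hB₉ ha₀ ha₁'
        (variationalThm1RegSepCoP7M_of_prop8TopStep hBpos (h8.of_le le_rfl (min_le_left _ _))) (gauge9R_cube_of_prop8TopStep_of_prop6Member F hBpos h8 hB₁ hc₁ hP6)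
    exact exists_k0H_of_prop8TopStep_of_prop6Member_of_clausesH F hm hB₃ ha₀ ha₁ h8 hB₁ hc₁ hP6 hγ0 hγ hε hε' hcomp hcompRev
  · exact h4 F (by omega)

end SignFree

/-! ## §3. THE SUPPLIER SIDE: NODE O's jets-free pair at a record gives the abs box (N26 BY NAME), hence 3ᴬ at A1's witness, hence K0⁷'s body end to end -/

section Supplier

variable {F : T4Family} {N : ℕ} [NeZero N]

/-- **★ ANY ABS BOX ON A WINDOW INSIDE `]0, θ.γ]` (N26's output shape) GIVES THE LETTERS BOX ON A SHRUNK WINDOW `γ ≤ min(θ.γ, ½)`** (Dʷ §0) — Dʷ §3's hypotheses for every Stage-13 parameter.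
(node O P3 g48 §5.) [cite: Balaban1987RG1, §1 p.264 (bookkeeping)] -/
theorem exists_windowLettersBox_of_absBox (θ : Stage13Params F N)
    (h : ∃ γ₀ : ℝ, 0 < γ₀ ∧ γ₀ ≤ θ.γ ∧ ∃ β' : ℝ, 0 ≤ β' ∧
      BetaUpperH β' γ₀ (betaOfRecord₁₃ F N θ) ∧ BetaLowerH (-β') γ₀ (betaOfRecord₁₃ F N θ) ∧ BetaContH γ₀ (betaOfRecord₁₃ F N θ)) :
    ∃ γ : ℝ, 0 < γ ∧ γ ≤ θ.γ ∧ γ ≤ 1 / 2 ∧ ∃ β' : ℝ, 0 ≤ β' ∧ -(-β') * γ ^ 2 ≤ 3 ∧ β' * γ ^ 2 ≤ 3 / 4 ∧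
      BetaLowerH (-β') γ (betaOfRecord₁₃ F N θ) ∧ BetaUpperH β' γ (betaOfRecord₁₃ F N θ) := by
  obtain ⟨γ₀, hγ0, hle, β', hβ', hup, hlow, -⟩ := h
  obtain ⟨γ, hγpos, hγle, hγhalf, hl, hu⟩ := exists_window_letters_signFree hγ0 hβ'
  exact ⟨γ, hγpos, hγle.trans hle, hγhalf, β', hβ', hl, hu, fun k v hv => hlow k v (box_mono hγle k hv), fun k v hv => hup k v (box_mono hγle k hv)⟩

/-- **★★ THE JUNCTION, N26 BY NAME — NODE O's JETS-FREE PAIR AT A1's WITNESS `θ₁₅ᶜᶜᴹ(3)`, for every guarded constants tuple carrying (8) and the R step fact, at SOME thresholds `ε₀, ε₂₉ > 0`,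
SUPPLIES 3ᴬ** («`∃ d ≥ 0, A, OneLoopDrift d A β⁰_θ ∧ ∃ γ₀ ∈ ]0, θ.γ], AtSlopeCont (split₁₃ θ) γ₀ d`» at `θ = θ₁₅ᶜᶜᴹ(3; ε₀, ε₂₉; …)` — the hypothesis of N26's `exists_betaBox_betaOfRecord₁₃_of_jetsFreePair`
VERBATIM, = dag-n26-c's `registeredPair₁₃_iff_jetsFreePair` right-hand side = K2⁗'s two stub bodies read at that record).  This is the supplier ∕ consumer junction the signed texts 3′∕3ʷ∕3ˢ∕3ᵀ do
not have.  CONDITIONAL on the pair; NOT proved; no sign; nothing of Bałaban asserted.  (node O P3 g48 §5.) [cite: Balaban1987RG1, Thm 2 p.259, §1 p.264, (2.12)–(2.14) p.268, (5.10) p.293; Balaban1988RG2Cluster, Lemma 3 (2.38) p.20; Balaban1985Variational, Thm 1 p.279, Prop. 8 p.304] -/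
theorem absBetaBox_of_jetsFreePair (F : T4Family)
    (h : ∀ B₃ B₃' a₀ a₁ : ℝ, 2 * (F.L : ℝ) ^ 2 ≤ B₃ → 0 < B₃' → 0 < a₀ → 0 < a₁ →
      VariationalThm1RegSepCoP7M F 2 B₃ a₀ a₁ →
      Gauge9RegSepTopStepR F 2 (fun ν K Ω => suppDomOfRecord F ν K Ω) (F.L ^ 3) ((11 * 4 + 3 * F.L) * F.L) B₃ B₃' a₀ a₁ →
      ∃ ε₀ ε₂₉ : ℝ, 0 < ε₀ ∧ 0 < ε₂₉ ∧
        (letI := (theta13OfThm1CCM F 2 3 ε₀ ε₂₉ B₃ B₃' a₀ a₁).instVβ₁; letI := (theta13OfThm1CCM F 2 3 ε₀ ε₂₉ B₃ B₃' a₀ a₁).instVβ₂;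
         letI := (theta13OfThm1CCM F 2 3 ε₀ ε₂₉ B₃ B₃' a₀ a₁).instιβ
         ∃ d A : ℝ, 0 ≤ d ∧
           OneLoopDrift d A (beta0OfMerged (betaMerged F (mergedTermFamilyMatT F 2 (TcanOfRecord F 2)
             (chiFixed29 F 2 (theta13OfThm1CCM F 2 3 ε₀ ε₂₉ B₃ B₃' a₀ a₁).ν (theta13OfThm1CCM F 2 3 ε₀ ε₂₉ B₃ B₃' a₀ a₁).ε₂₉) (theta13OfThm1CCM F 2 3 ε₀ ε₂₉ B₃ B₃' a₀ a₁).εbg)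
             (theta13OfThm1CCM F 2 3 ε₀ ε₂₉ B₃ B₃' a₀ a₁).ρ8 (theta13OfThm1CCM F 2 3 ε₀ ε₂₉ B₃ B₃' a₀ a₁).bV) (theta13OfThm1CCM F 2 3 ε₀ ε₂₉ B₃ B₃' a₀ a₁).v₀) ∧
           ∃ γ₀ : ℝ, 0 < γ₀ ∧ γ₀ ≤ (theta13OfThm1CCM F 2 3 ε₀ ε₂₉ B₃ B₃' a₀ a₁).γ ∧
             AtSlopeCont
               (oneLoopSplit_betaOfMerged
                 (betaMerged F (mergedTermFamilyMatT F 2 (TcanOfRecord F 2)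
                   (chiFixed29 F 2 (theta13OfThm1CCM F 2 3 ε₀ ε₂₉ B₃ B₃' a₀ a₁).ν (theta13OfThm1CCM F 2 3 ε₀ ε₂₉ B₃ B₃' a₀ a₁).ε₂₉) (theta13OfThm1CCM F 2 3 ε₀ ε₂₉ B₃ B₃' a₀ a₁).εbg)
                   (theta13OfThm1CCM F 2 3 ε₀ ε₂₉ B₃ B₃' a₀ a₁).ρ8 (theta13OfThm1CCM F 2 3 ε₀ ε₂₉ B₃ B₃' a₀ a₁).bV)
                 (beta0OfMerged (betaMerged F (mergedTermFamilyMatT F 2 (TcanOfRecord F 2)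
                   (chiFixed29 F 2 (theta13OfThm1CCM F 2 3 ε₀ ε₂₉ B₃ B₃' a₀ a₁).ν (theta13OfThm1CCM F 2 3 ε₀ ε₂₉ B₃ B₃' a₀ a₁).ε₂₉) (theta13OfThm1CCM F 2 3 ε₀ ε₂₉ B₃ B₃' a₀ a₁).εbg)
                   (theta13OfThm1CCM F 2 3 ε₀ ε₂₉ B₃ B₃' a₀ a₁).ρ8 (theta13OfThm1CCM F 2 3 ε₀ ε₂₉ B₃ B₃' a₀ a₁).bV) (theta13OfThm1CCM F 2 3 ε₀ ε₂₉ B₃ B₃' a₀ a₁).v₀)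
                 (theta13OfThm1CCM F 2 3 ε₀ ε₂₉ B₃ B₃' a₀ a₁).γ)
               γ₀ d)) :
    ∀ B₃ B₃' a₀ a₁ : ℝ, 2 * (F.L : ℝ) ^ 2 ≤ B₃ → 0 < B₃' → 0 < a₀ → 0 < a₁ →
      VariationalThm1RegSepCoP7M F 2 B₃ a₀ a₁ →
      Gauge9RegSepTopStepR F 2 (fun ν K Ω => suppDomOfRecord F ν K Ω) (F.L ^ 3) ((11 * 4 + 3 * F.L) * F.L) B₃ B₃' a₀ a₁ →
      ∃ γ₀ ε₀ ε₂₉ β' : ℝ, 0 < γ₀ ∧ 0 < ε₀ ∧ 0 < ε₂₉ ∧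
        BetaLowerH (-β') γ₀ (betaOfRecord₁₃ F 2 (theta13OfThm1CCM F 2 3 ε₀ ε₂₉ B₃ B₃' a₀ a₁)) ∧
        BetaUpperH β' γ₀ (betaOfRecord₁₃ F 2 (theta13OfThm1CCM F 2 3 ε₀ ε₂₉ B₃ B₃' a₀ a₁)) := by
  intro B₃ B₃' a₀ a₁ hB₃ hB₃' ha₀ ha₁ h15 h9
  obtain ⟨ε₀, ε₂₉, hε, hε', hJ⟩ := h B₃ B₃' a₀ a₁ hB₃ hB₃' ha₀ ha₁ h15 h9
  obtain ⟨γ₀, hγ0, -, β', -, hup, hlow, -⟩ := exists_betaBox_betaOfRecord₁₃_of_jetsFreePair F 2 (theta13OfThm1CCM F 2 3 ε₀ ε₂₉ B₃ B₃' a₀ a₁) hJ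
  exact ⟨γ₀, ε₀, ε₂₉, β', hγ0, hε, hε', hlow, hup⟩

/-- **★★★★ END TO END, SIGN-FREE**: stub 1, stub 2 (texts as in Cʷ), NODE O's jets-free pair at A1's witness `θ₁₅ᶜᶜᴹ(3)` for every family and every guarded tuple, and the rider 4 ⟹ K0⁷'s body at
every family (`absBetaBox_of_jetsFreePair` ∘ `record13SepCoPHBody_of_stubsA`).  CONDITIONAL; K0⁷ NOT closed; nothing of Bałaban asserted; no sign of β anywhere.  (node O P3 g48 §5.)
[cite: Balaban1985Variational, Thm 1 (8)–(9) p.279, Prop. 8 p.304; Balaban1985RegularSpaces, Prop. 6 p.99; Balaban1988Convergent, Thm 1 p.262, (2.6)–(2.8) pp.255–256; Balaban1987RG1, Thm 1 p.259, Thm 2 p.259, §1 p.264, (2.12)–(2.14) p.268, (5.10) p.293; Balaban1988RG2Cluster, Lemma 3 (2.38) p.20] -/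
theorem record13SepCoPHBody_of_stubs12_jetsFreePair_rider
    (h1 : ∀ F : T4Family, ∃ B₃ a₀ a₁ : ℝ, 2 * (F.L : ℝ) ^ 2 ≤ B₃ ∧ 0 < a₀ ∧ 0 < a₁ ∧
      Prop8RegSepTopStep F 2 (fun ν K Ω => suppDomOfRecord F ν K Ω) B₃ a₀ a₁)
    (h2 : ∀ F : T4Family, ∃ B₁ c₁ : ℝ, 0 ≤ B₁ ∧ 0 < c₁ ∧
      (letI : CStarAlgebra (MatA 2) := {}; B8.Prop6Printed 4 (F.L : ℝ) B₁ c₁ (fun i : B8LeafModelZd.ZdIdx 4 F.L => zdCub (MatA 2) F.L i)))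
    (h3J : ∀ (F : T4Family) (B₃ B₃' a₀ a₁ : ℝ), 2 * (F.L : ℝ) ^ 2 ≤ B₃ → 0 < B₃' → 0 < a₀ → 0 < a₁ →
      VariationalThm1RegSepCoP7M F 2 B₃ a₀ a₁ →
      Gauge9RegSepTopStepR F 2 (fun ν K Ω => suppDomOfRecord F ν K Ω) (F.L ^ 3) ((11 * 4 + 3 * F.L) * F.L) B₃ B₃' a₀ a₁ →
      ∃ ε₀ ε₂₉ : ℝ, 0 < ε₀ ∧ 0 < ε₂₉ ∧
        (letI := (theta13OfThm1CCM F 2 3 ε₀ ε₂₉ B₃ B₃' a₀ a₁).instVβ₁; letI := (theta13OfThm1CCM F 2 3 ε₀ ε₂₉ B₃ B₃' a₀ a₁).instVβ₂;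
         letI := (theta13OfThm1CCM F 2 3 ε₀ ε₂₉ B₃ B₃' a₀ a₁).instιβ
         ∃ d A : ℝ, 0 ≤ d ∧
           OneLoopDrift d A (beta0OfMerged (betaMerged F (mergedTermFamilyMatT F 2 (TcanOfRecord F 2)
             (chiFixed29 F 2 (theta13OfThm1CCM F 2 3 ε₀ ε₂₉ B₃ B₃' a₀ a₁).ν (theta13OfThm1CCM F 2 3 ε₀ ε₂₉ B₃ B₃' a₀ a₁).ε₂₉) (theta13OfThm1CCM F 2 3 ε₀ ε₂₉ B₃ B₃' a₀ a₁).εbg)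
             (theta13OfThm1CCM F 2 3 ε₀ ε₂₉ B₃ B₃' a₀ a₁).ρ8 (theta13OfThm1CCM F 2 3 ε₀ ε₂₉ B₃ B₃' a₀ a₁).bV) (theta13OfThm1CCM F 2 3 ε₀ ε₂₉ B₃ B₃' a₀ a₁).v₀) ∧
           ∃ γ₀ : ℝ, 0 < γ₀ ∧ γ₀ ≤ (theta13OfThm1CCM F 2 3 ε₀ ε₂₉ B₃ B₃' a₀ a₁).γ ∧
             AtSlopeCont
               (oneLoopSplit_betaOfMerged
                 (betaMerged F (mergedTermFamilyMatT F 2 (TcanOfRecord F 2)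
                   (chiFixed29 F 2 (theta13OfThm1CCM F 2 3 ε₀ ε₂₉ B₃ B₃' a₀ a₁).ν (theta13OfThm1CCM F 2 3 ε₀ ε₂₉ B₃ B₃' a₀ a₁).ε₂₉) (theta13OfThm1CCM F 2 3 ε₀ ε₂₉ B₃ B₃' a₀ a₁).εbg)
                   (theta13OfThm1CCM F 2 3 ε₀ ε₂₉ B₃ B₃' a₀ a₁).ρ8 (theta13OfThm1CCM F 2 3 ε₀ ε₂₉ B₃ B₃' a₀ a₁).bV)
                 (beta0OfMerged (betaMerged F (mergedTermFamilyMatT F 2 (TcanOfRecord F 2)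
                   (chiFixed29 F 2 (theta13OfThm1CCM F 2 3 ε₀ ε₂₉ B₃ B₃' a₀ a₁).ν (theta13OfThm1CCM F 2 3 ε₀ ε₂₉ B₃ B₃' a₀ a₁).ε₂₉) (theta13OfThm1CCM F 2 3 ε₀ ε₂₉ B₃ B₃' a₀ a₁).εbg)
                   (theta13OfThm1CCM F 2 3 ε₀ ε₂₉ B₃ B₃' a₀ a₁).ρ8 (theta13OfThm1CCM F 2 3 ε₀ ε₂₉ B₃ B₃' a₀ a₁).bV) (theta13OfThm1CCM F 2 3 ε₀ ε₂₉ B₃ B₃' a₀ a₁).v₀)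
                 (theta13OfThm1CCM F 2 3 ε₀ ε₂₉ B₃ B₃' a₀ a₁).γ)
               γ₀ d))
    (h4 : ∀ F : T4Family, F.m ≤ 3 → ∃ θ : Stage13HParams F 2, θ.Provisos₁₃SepCoPH F 2 ∧ (θ.ZhUnity F 2 ∧ θ.SlotsNondegenerate₁₃ F 2) ∧ θ.Admissible F 2) :
    ∀ F : T4Family, ∃ θ : Stage13HParams F 2, θ.Provisos₁₃SepCoPH F 2 ∧ (θ.ZhUnity F 2 ∧ θ.SlotsNondegenerate₁₃ F 2) ∧ θ.Admissible F 2 :=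
  record13SepCoPHBody_of_stubsA h1 h2 (fun F => absBetaBox_of_jetsFreePair F (h3J F)) h4

end Supplier

end Summit.QuantumFields.YangMills.Theorems.K0SignFreeOfStepTokensRCube

end
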